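import Literature.AlgebraicGeometry.Motives.VarietiesProjectiveSpaceProofs
import Mathlib.Algebra.MvPolynomial.PDeriv
import Mathlib.RingTheory.Polynomial.UniqueFactorization
import HarnessLib

/-!
# Dehomogenisation: evaluation, partial derivatives, homogeneous lifts, irreducibility

Family `hodge` (support for the Jacobian criterion for projective hypersurfaces,
`Literature.AlgebraicGeometry.HodgeTheory.Hartshorne1977_smoothHypersurface_jacobian`), layer
`Literature/AlgebraicGeometry/Motives`. Theorems only, about the dehomogenisation map
`Literature.AlgebraicGeometry.Motives.ProjectiveSpace.dehomogenize R i : R[x₀,…,xₙ] → R[y₁,…,yₙ]`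
(`xᵢ ↦ 1`, `x_{i.succAbove j} ↦ yⱼ`) of `Motives/VarietiesProjectiveSpaceProofs`
(Hartshorne, *Algebraic Geometry*, I §2, proof of Prop. 2.2: the maps `α` (dehomogenise) and `β`
(homogenise, `β(g) = x₀ᵉ g(x₁/x₀, …, xₙ/x₀)`, `e = deg g`) between `k[y₁,…,yₙ]` and the homogeneous
elements of `k[x₀,…,xₙ]`; I Ex. 2.9–2.10, II Prop. 2.5(b)):

* `eval_dehomogenize`: `(dehomogenize F)(z ∘ i.succAbove) = F(z)` when `zᵢ = 1`;
* `pderiv_dehomogenize`: `∂/∂yⱼ ∘ dehomogenize = dehomogenize ∘ ∂/∂x_{i.succAbove j}`;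
* `dehomogenize_rename_succAbove`: `α(g(x_{i.succAbove ·})) = g`;
* `exists_isHomogeneous_dehomogenize_eq`: every `g` with `deg g ≤ e` is `α(G)` for some `G`
  homogeneous of degree `e` (`G = Σₘ xᵢ^{e-m} · gₘ(x_{i.succAbove ·})`, `gₘ` the homogeneous
  components — Hartshorne's `β` padded to degree `e`);
* `eq_of_dehomogenize_eq` (over a domain): two homogeneous polynomials of the same degree with the
  same dehomogenisation are equal (`α` is injective on `R[x]ₑ`: `G/xᵢᵉ ↦ α(G)` is the chart
  isomorphism `(R[x]_{xᵢ})₀ ≅ R[y]`, `ProjectiveSpace.chartAlgEquiv`);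
* `irreducible_or_isUnit_dehomogenize` (over a field): if `F` is irreducible and homogeneous then
  `α(F)` is irreducible or a unit (the unit case being `F ∼ xᵢ`) — Hartshorne I Ex. 2.10 / proof of
  Prop. 2.2 («`α` and `β` … irreducible»), via unique factorisation in `k[x₀,…,xₙ]`.

## References

* R. Hartshorne, *Algebraic Geometry*, GTM 52, Springer 1977: I §2, proof of Prop. 2.2 (p. 10–11),
  I Ex. 2.9, 2.10, I Ex. 5.8.
-/

noncomputable section

open MvPolynomial

universe u

namespace Literature.AlgebraicGeometry.Motives

namespace ProjectiveSpace

variable (R : Type u) [CommRing R] {n : ℕ} (i : Fin (n + 1))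

/-! ## Evaluation and partial derivatives -/

variable {R} in
/-- `(dehomogenize F)(z₀,…,ẑᵢ,…,zₙ) = F(z)` for `z` with `zᵢ = 1`. [folklore] -/
theorem eval_dehomogenize (z : Fin (n + 1) → R) (hz : z i = 1) (F : MvPolynomial (Fin (n + 1)) R) :
    eval (fun j => z (i.succAbove j)) (dehomogenize R i F) = eval z F := by
  have hfun : (eval fun j => z (i.succAbove j)) ∘
      (Fin.insertNth (α := fun _ => MvPolynomial (Fin n) R) i 1 X) = z := by
    funext s
    rcases Fin.eq_self_or_eq_succAbove i s with rfl | ⟨j, rfl⟩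
    · simp [hz]
    · simp
  have h1 : (eval fun j => z (i.succAbove j)).comp (algebraMap R (MvPolynomial (Fin n) R)) =
      RingHom.id R := by
    ext r
    simp
  rw [dehomogenize, aeval_def, eval₂_comp_left, h1, hfun]
  rfl

variable {R} in
/-- Dehomogenisation commutes with the partial derivatives in the surviving variables:
`∂(α F)/∂yⱼ = α(∂F/∂x_{i.succAbove j})`. [folklore] -/
theorem pderiv_dehomogenize (j : Fin n) (F : MvPolynomial (Fin (n + 1)) R) :
    pderiv j (dehomogenize R i F) = dehomogenize R i (pderiv (i.succAbove j) F) := by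
  classical
  induction F using MvPolynomial.induction_on with
  | C c => simp [dehomogenize]
  | add p q hp hq => simp only [map_add, hp, hq]
  | mul_X p s hp =>
      rw [map_mul, pderiv_mul, hp, pderiv_mul, map_add, map_mul, map_mul, pderiv_X]
      congr 2
      rcases Fin.eq_self_or_eq_succAbove i s with rfl | ⟨l, rfl⟩
      · rw [dehomogenize_X_self, Pi.single_apply, if_neg (Fin.succAbove_ne s j).symm, map_zero]
        exact (pderiv j).map_one_eq_zero
      · rw [dehomogenize_X_succAbove, pderiv_X, Pi.single_apply, Pi.single_apply]
        by_cases h : l = j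
        · subst h
          rw [if_pos rfl, if_pos rfl, map_one]
        · rw [if_neg h, if_neg (fun h' => h (Fin.succAbove_right_injective h')), map_zero]

/-! ## Homogeneous lifts -/

/-- `α(g(x_{i.succAbove ·})) = g`: dehomogenising a polynomial not involving `xᵢ` just renames the
variables back. [folklore] -/
theorem dehomogenize_rename_succAbove (g : MvPolynomial (Fin n) R) :
    dehomogenize R i (rename i.succAbove g) = g := by
  rw [dehomogenize, aeval_rename]
  have : (Fin.insertNth (α := fun _ => MvPolynomial (Fin n) R) i 1 X) ∘ i.succAbove = X := by
    funext j
    simp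
  rw [this, aeval_X_left, AlgHom.coe_id, id_eq]

/-- **Homogenisation** (Hartshorne's `β`, padded): every `g ∈ R[y₁,…,yₙ]` with `deg g ≤ e` is the
dehomogenisation of a homogeneous `G ∈ R[x₀,…,xₙ]` of degree `e`, namely
`G = Σₘ xᵢ^{e-m} gₘ(x_{i.succAbove ·})` with `gₘ` the homogeneous component of degree `m` of `g`.
[cite: Hartshorne1977, I §2, proof of Prop. 2.2] -/
theorem exists_isHomogeneous_dehomogenize_eq (g : MvPolynomial (Fin n) R) {e : ℕ}
    (he : g.totalDegree ≤ e) :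
    ∃ G : MvPolynomial (Fin (n + 1)) R, G.IsHomogeneous e ∧ dehomogenize R i G = g := by
  refine ⟨∑ m ∈ Finset.range (e + 1),
    X i ^ (e - m) * rename i.succAbove (homogeneousComponent m g), ?_, ?_⟩
  · refine IsHomogeneous.sum _ _ _ fun m hm => ?_
    have hm' : m ≤ e := Nat.lt_succ_iff.mp (Finset.mem_range.mp hm)
    have h1 : (X i ^ (e - m) : MvPolynomial (Fin (n + 1)) R).IsHomogeneous (1 * (e - m)) :=
      (isHomogeneous_X R i).pow (e - m)
    have h2 : (rename i.succAbove (homogeneousComponent m g)).IsHomogeneous m :=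
      (homogeneousComponent_isHomogeneous m g).rename_isHomogeneous
    have := h1.mul h2
    rwa [one_mul, Nat.sub_add_cancel hm'] at this
  · rw [map_sum]
    have hterm : ∀ m ∈ Finset.range (e + 1), dehomogenize R i
        (X i ^ (e - m) * rename i.succAbove (homogeneousComponent m g)) =
        homogeneousComponent m g := fun m _ => by
      rw [map_mul, map_pow, dehomogenize_X_self, one_pow, one_mul, dehomogenize_rename_succAbove]
    rw [Finset.sum_congr rfl hterm]
    rw [← Finset.sum_subset (Finset.range_subset_range.mpr (Nat.succ_le_succ he))
      (fun m _ hm => homogeneousComponent_eq_zero m g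
        (by have := Finset.mem_range.not.mp hm; omega))]
    exact sum_homogeneousComponent g

/-! ## Injectivity on homogeneous polynomials of a fixed degree -/

variable {R} in
/-- Euler's identity in `R[x]_{xᵢ}` (any localisation `S` of `R[x₀,…,xₙ]` away from `xᵢ`): for `P`
homogeneous of degree `e`, `P = xᵢᵉ · (α P)(x_{i.succAbove ·}/xᵢ)` (Hartshorne I Thm. 3.4, proof;
`isHomogeneous_aeval_const_mul` with `c = 1/xᵢ`). [folklore] -/
theorem algebraMap_eq_X_pow_mul_aeval_dehomogenize {S : Type*} [CommRing S] [Algebra R S]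
    [Algebra (MvPolynomial (Fin (n + 1)) R) S] [IsScalarTower R (MvPolynomial (Fin (n + 1)) R) S]
    [IsLocalization.Away (X i : MvPolynomial (Fin (n + 1)) R) S]
    {e : ℕ} {P : MvPolynomial (Fin (n + 1)) R} (hP : P.IsHomogeneous e) :
    algebraMap (MvPolynomial (Fin (n + 1)) R) S P =
      algebraMap (MvPolynomial (Fin (n + 1)) R) S (X i) ^ e *
        aeval (fun j => IsLocalization.Away.invSelf (S := S) (X i : MvPolynomial (Fin (n + 1)) R) *
          algebraMap (MvPolynomial (Fin (n + 1)) R) S (X (i.succAbove j))) (dehomogenize R i P) := by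
  set u : S := IsLocalization.Away.invSelf (S := S) (X i : MvPolynomial (Fin (n + 1)) R) with hu
  have hu1 : u * algebraMap (MvPolynomial (Fin (n + 1)) R) S (X i) = 1 := by
    rw [mul_comm, hu, IsLocalization.Away.mul_invSelf]
  -- `P(u·x) = (α P)(u·x_{i.succAbove ·})`
  have hfac : aeval (fun s => u * algebraMap (MvPolynomial (Fin (n + 1)) R) S (X s)) P =
      aeval (fun j => u * algebraMap (MvPolynomial (Fin (n + 1)) R) S (X (i.succAbove j)))
        (dehomogenize R i P) := by
    rw [dehomogenize, ← AlgHom.comp_apply]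
    congr 1
    refine MvPolynomial.algHom_ext fun s => ?_
    rw [AlgHom.comp_apply, aeval_X, aeval_X]
    rcases Fin.eq_self_or_eq_succAbove i s with rfl | ⟨j, rfl⟩
    · rw [hu1]
      simp
    · simp
  have hid : aeval (fun s => algebraMap (MvPolynomial (Fin (n + 1)) R) S (X s)) P =
      algebraMap (MvPolynomial (Fin (n + 1)) R) S P := by
    have : aeval (fun s => algebraMap (MvPolynomial (Fin (n + 1)) R) S (X s)) =
        IsScalarTower.toAlgHom R (MvPolynomial (Fin (n + 1)) R) S := by
      ext s
      simp
    simp [this]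
  rw [← hfac, isHomogeneous_aeval_const_mul hP, hid, ← mul_assoc, ← mul_pow, mul_comm _ u, hu1,
    one_pow, one_mul]

variable {R} in
/-- Two homogeneous polynomials of the same degree with the same dehomogenisation are equal
(`R` a domain): by Euler's identity both equal `xᵢᵉ · (α G)(x/xᵢ)` in `R[x]_{xᵢ}`, into which `R[x]`
embeds. [cite: Hartshorne1977, I §2, proof of Prop. 2.2] -/
theorem eq_of_dehomogenize_eq [IsDomain R] {e : ℕ} {G H : MvPolynomial (Fin (n + 1)) R}
    (hG : G.IsHomogeneous e) (hH : H.IsHomogeneous e)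
    (h : dehomogenize R i G = dehomogenize R i H) : G = H := by
  have hinj : Function.Injective (algebraMap (MvPolynomial (Fin (n + 1)) R)
      (Localization.Away (X i : MvPolynomial (Fin (n + 1)) R))) :=
    IsLocalization.injective _ (powers_le_nonZeroDivisors_of_noZeroDivisors (X_ne_zero i))
  apply hinj
  rw [algebraMap_eq_X_pow_mul_aeval_dehomogenize i (S := Localization.Away _) hG,
    algebraMap_eq_X_pow_mul_aeval_dehomogenize i (S := Localization.Away _) hH, h]

/-! ## Irreducibility -/

variable {k : Type u} [Field k]

/-- **Dehomogenisation preserves irreducibility up to the variable `xᵢ`** (Hartshorne I, proof of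
Prop. 2.2 and Ex. 2.10: `α`, `β` respect products). If `F ∈ k[x₀,…,xₙ]` is irreducible and
homogeneous, then `α(F) = F(xᵢ := 1)` is irreducible, unless it is a unit (which happens exactly
when `F ∼ xᵢ`). Proof: if `α(F) = g h`, lift `g, h` to homogeneous `G, H` (`β`); then
`G · H · xᵢᵈ` and `F · xᵢ^{deg g + deg h}` are homogeneous of the same degree with the same image
under `α`, hence equal, and `F` is prime in the factorial ring `k[x₀,…,xₙ]`.
[cite: Hartshorne1977, I §2, proof of Prop. 2.2 and Ex. 2.10] -/
theorem irreducible_or_isUnit_dehomogenize {d : ℕ} {F : MvPolynomial (Fin (n + 1)) k}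
    (hF : F.IsHomogeneous d) (hirr : Irreducible F) :
    Irreducible (dehomogenize k i F) ∨ IsUnit (dehomogenize k i F) := by
  classical
  set f := dehomogenize k i F with hf
  by_cases hu : IsUnit f
  · exact Or.inr hu
  refine Or.inl (irreducible_iff.mpr ⟨hu, fun g h hgh => ?_⟩)
  have hf0 : f ≠ 0 := by
    intro h0
    apply hirr.ne_zero
    exact eq_of_dehomogenize_eq i hF (isHomogeneous_zero _ _ d) (by rw [← hf, h0, map_zero])
  have hg0 : g ≠ 0 := fun h0 => hf0 (by rw [hgh, h0, zero_mul])
  have hh0 : h ≠ 0 := fun h0 => hf0 (by rw [hgh, h0, mul_zero])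
  obtain ⟨G, hG, hGg⟩ := exists_isHomogeneous_dehomogenize_eq k i g le_rfl
  obtain ⟨H, hH, hHh⟩ := exists_isHomogeneous_dehomogenize_eq k i h le_rfl
  -- `G H xᵢᵈ = F xᵢ^{deg g + deg h}`
  have hX1 : (X i : MvPolynomial (Fin (n + 1)) k).IsHomogeneous 1 := isHomogeneous_X k i
  have key : G * H * X i ^ d = F * X i ^ (g.totalDegree + h.totalDegree) := by
    refine eq_of_dehomogenize_eq i (e := g.totalDegree + h.totalDegree + 1 * d) ?_ ?_ ?_
    · exact (hG.mul hH).mul (hX1.pow d)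
    · have e1 : d + 1 * (g.totalDegree + h.totalDegree) =
          g.totalDegree + h.totalDegree + 1 * d := by ring
      exact e1 ▸ hF.mul (hX1.pow (g.totalDegree + h.totalDegree))
    · simp only [map_mul, map_pow, dehomogenize_X_self, one_pow, mul_one, hGg, hHh]
      exact hgh.symm
  have hprime : Prime F := hirr.prime
  have hdvd : F ∣ G * H * X i ^ d := ⟨_, key⟩
  rcases hprime.dvd_or_dvd hdvd with hGH | hXd
  · rcases hprime.dvd_or_dvd hGH with ⟨K, hK⟩ | ⟨K, hK⟩
    · -- `F ∣ G`: then `h` is a unit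
      right
      have h1 : g = g * (h * dehomogenize k i K) := by
        conv_lhs => rw [← hGg, hK, map_mul, ← hf, hgh]
        ring
      have h2 : h * dehomogenize k i K = 1 :=
        (mul_right_inj' hg0).mp (by rw [← h1, mul_one])
      exact IsUnit.of_mul_eq_one _ h2
    · -- `F ∣ H`: then `g` is a unit
      left
      have h1 : h = h * (g * dehomogenize k i K) := by
        conv_lhs => rw [← hHh, hK, map_mul, ← hf, hgh]
        ring
      have h2 : g * dehomogenize k i K = 1 :=
        (mul_right_inj' hh0).mp (by rw [← h1, mul_one])
      exact IsUnit.of_mul_eq_one _ h2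
  · -- `F ∣ xᵢ`: then `f` is a unit, excluded
    exfalso
    obtain ⟨K, hK⟩ := hprime.dvd_of_dvd_pow hXd
    apply hu
    have : f * dehomogenize k i K = 1 := by
      rw [hf, ← map_mul, ← hK, dehomogenize_X_self]
    exact IsUnit.of_mul_eq_one _ this

end ProjectiveSpace

end Literature.AlgebraicGeometry.Motives
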